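import Literature.Analysis.OperatorTheory.PathKernelDomination
import Literature.Analysis.OperatorTheory.CompactSelfAdjointEigenbasis
import Literature.Analysis.OperatorTheory.PositiveKernelSpectralTraceTwo
import Literature.Analysis.OperatorTheory.PositivityImprovingSpectralGap
import Literature.Analysis.OperatorTheory.JointEigenbasis
import HarnessLib

/-!
# Trace formulas for the composition powers of a strictly positive kernel of positive type, with a spectral gap

Topic `Literature/Analysis/OperatorTheory`; companion of `PositiveKernelTransferOperator.lean`, `KernelIterateBridge.lean`,
`PositiveKernelSpectralTrace{,Two}.lean`, `PositivityImprovingSpectralGap.lean` (Mathlib + companions only, no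
definitions).  For a family of bounded symmetric kernels `k_m` on a probability space that are the composition powers
of `k_0` (`∫ k_0(x, y) k_m(y, z) dμ(y) = k_{m+1}(x, z)`), `k_0` strictly positive and of positive type:

* `integral_kernel_mul_integral_kernel_mul_Lp` — Fubini for two bounded kernels against an `L²` function;
* `exists_gap_hasSum_pow_integral_cyclic` (**main**) — eigen-data `(νᵢ)`, `i₀`, `θ` of the `L²` operator of `k_0`
  with `0 ≤ νᵢ`, `0 < ν_{i₀}`, `0 ≤ θ < ν_{i₀}`, `νᵢ ≤ θ` off `i₀` (Jentzsch's gap,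
  `IsPositivityImproving.exists_spectralGap`), `Σ νᵢ² < ∞`, and the trace formulas
  `∫ ∏_{t : Fin (M+2)} k_m(V t, V (t+1)) dμ^{⊗(M+2)} = Σᵢ (νᵢ^{m+1})^{M+2}` for ALL `m, M` (the operator of `k_m` is
  the `(m+1)`-st power of that of `k_0`);
* `vdr_of_spectralGap` — the resulting two-sided trace domination ("vacuum dominance with a rate"): for every
  `m₀ > 0` there are `C ≥ 0`, `L_min ≥ 1` with `(ν_{i₀}^L)^{M+2} ≤ Σᵢ (νᵢ^L)^{M+2} ≤ (ν_{i₀}^L)^{M+2} exp(C L e^{−m₀(M+2)})`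
  for `L ≥ L_min`.

References: Reed–Simon IV §XIII.12 (Thms XIII.43–44); B. Simon, *Trace Ideals* (2005) Ch. 3. [folklore]
-/

set_option autoImplicit false

noncomputable section

open MeasureTheory Filter Set Function
open scoped RealInnerProductSpace ENNReal BigOperators

namespace Literature.Analysis.OperatorTheory

/-! ### Fubini for two bounded kernels against an `L²` function -/

section Fubini

variable {X : Type*} [MeasurableSpace X] {μ : Measure X} [IsFiniteMeasure μ]

/-- **Fubini for two bounded kernels against an `L²` function**:
`∫ K₀(w,y) (∫ K₁(y,z) φ(z)) dy = ∫ (∫ K₀(w,y) K₁(y,z) dy) φ(z) dz` (`φ ∈ L² ⊂ L¹` on a finite measure space).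
[folklore] -/
theorem integral_kernel_mul_integral_kernel_mul_Lp {K₀ K₁ : X → X → ℝ} {C₀ C₁ : ℝ}
    (hK₀ : StronglyMeasurable (uncurry K₀)) (hK₁ : StronglyMeasurable (uncurry K₁))
    (hC₀ : ∀ x y, ‖K₀ x y‖ ≤ C₀) (hC₁ : ∀ x y, ‖K₁ x y‖ ≤ C₁) (φ : Lp ℝ 2 μ) (w : X) :
    ∫ y, K₀ w y * ∫ z, K₁ y z * φ z ∂μ ∂μ = ∫ z, (∫ y, K₀ w y * K₁ y z ∂μ) * φ z ∂μ := by
  have hC₀0 : 0 ≤ C₀ := (norm_nonneg _).trans (hC₀ w w)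
  have hint : Integrable (fun p : X × X => K₀ w p.1 * (K₁ p.1 p.2 * φ p.2)) (μ.prod μ) := by
    have h1 : Integrable (fun p : X × X => (1 : ℝ) * φ p.2) (μ.prod μ) :=
      (integrable_const (1 : ℝ)).mul_prod ((Lp.memLp φ).integrable one_le_two)
    have hm : AEStronglyMeasurable (fun p : X × X => K₀ w p.1 * K₁ p.1 p.2) (μ.prod μ) :=
      ((hK₀.measurable.comp (measurable_const.prodMk measurable_fst)).mul hK₁.measurable).aestronglyMeasurable
    have h2 := h1.bdd_mul hm (c := C₀ * C₁) (Eventually.of_forall fun p => by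
      rw [norm_mul]
      exact mul_le_mul (hC₀ _ _) (hC₁ _ _) (norm_nonneg _) hC₀0)
    refine h2.congr (Eventually.of_forall fun p => ?_)
    dsimp only
    ring
  calc ∫ y, K₀ w y * ∫ z, K₁ y z * φ z ∂μ ∂μ = ∫ y, ∫ z, K₀ w y * (K₁ y z * φ z) ∂μ ∂μ := by
        refine integral_congr_ae (Eventually.of_forall fun y => ?_)
        exact (integral_const_mul _ _).symm
    _ = ∫ z, ∫ y, K₀ w y * (K₁ y z * φ z) ∂μ ∂μ := integral_integral_swap hint
    _ = ∫ z, (∫ y, K₀ w y * K₁ y z ∂μ) * φ z ∂μ := by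
        refine integral_congr_ae (Eventually.of_forall fun z => ?_)
        show ∫ y, K₀ w y * (K₁ y z * φ z) ∂μ = (∫ y, K₀ w y * K₁ y z ∂μ) * φ z
        rw [← integral_mul_const]
        refine integral_congr_ae (Eventually.of_forall fun y => ?_)
        ring

end Fubini

/-! ### Eigen-data, gap and trace formulas for the composition powers -/

/-- **Gap and trace formulas for the composition powers of a strictly positive kernel of positive type.**  On a
probability space with countably generated σ-algebra let `k_m` (`m ∈ ℕ`) be jointly strongly measurable, bounded, symmetric kernels with
`∫ k_0(x, y) k_m(y, z) dμ(y) = k_{m+1}(x, z)`, `k_0 > 0` pointwise and of positive type against bounded measurable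
functions.  Then there are eigen-data `(νᵢ)`, `i₀`, `θ` with `0 ≤ νᵢ`, `0 < ν_{i₀}`, `0 ≤ θ < ν_{i₀}`, `νᵢ ≤ θ` for
`i ≠ i₀`, `Σ νᵢ² < ∞`, and for all `m, M`:
`∫ ∏_{t : Fin (M+2)} k_m(V t, V (t+1)) dμ^{⊗(M+2)}(V) = Σᵢ (νᵢ^{m+1})^{M+2}` — the eigenbasis of the compact
self-adjoint positivity improving `L²` operator `A` of `k_0` (Hilbert–Schmidt theorem, Lüscher positivity, Jentzsch's
theorem `IsPositivityImproving.exists_spectralGap`), the kernel formula `A^{m+1} φ = ∫ k_m(·, y) φ(y)` (Fubini) and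
`hasSum_pow_integral_cyclic`. [cite: ReedSimonIV1978, Thm XIII.43 and Thm XIII.44] -/
theorem exists_gap_hasSum_pow_integral_cyclic {X : Type} [MeasurableSpace X] [MeasurableSpace.CountablyGenerated X]
    {μ : Measure X} [IsProbabilityMeasure μ] (k : ℕ → X → X → ℝ) (hkm : ∀ m, StronglyMeasurable (uncurry (k m)))
    (hkb : ∀ m, ∃ C : ℝ, ∀ x y, ‖k m x y‖ ≤ C) (hks : ∀ m x y, k m x y = k m y x) (hk0 : ∀ x y, 0 < k 0 x y)
    (hpt : ∀ f : X → ℝ, Measurable f → (∀ x, |f x| ≤ 1) → 0 ≤ ∫ x, ∫ y, f x * k 0 x y * f y ∂μ ∂μ)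
    (hcomp : ∀ m x z, ∫ y, k 0 x y * k m y z ∂μ = k (m + 1) x z) :
    ∃ (ι : Type) (ν : ι → ℝ) (i₀ : ι) (θ : ℝ), (∀ i, 0 ≤ ν i) ∧ 0 < ν i₀ ∧ 0 ≤ θ ∧ θ < ν i₀ ∧
      (∀ i, i ≠ i₀ → ν i ≤ θ) ∧ Summable (fun i => ν i ^ 2) ∧
      ∀ m M : ℕ, HasSum (fun i => (ν i ^ (m + 1)) ^ (M + 2))
        (∫ V : Fin (M + 2) → X, ∏ t, k m (V t) (V (t + 1)) ∂(Measure.pi fun _ => μ)) := by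
  classical
  obtain ⟨x₀, -⟩ := nonempty_of_measure_ne_zero (μ := μ) (s := univ) (by rw [measure_univ]; exact one_ne_zero)
  have hμ0 : μ ≠ 0 := IsProbabilityMeasure.ne_zero μ
  obtain ⟨C0, hC0⟩ := hkb 0
  have hC00 : 0 ≤ C0 := (norm_nonneg _).trans (hC0 x₀ x₀)
  -- the transfer operator of `k_0` and a countable eigenbasis
  obtain ⟨A, hA⟩ := exists_kernelOp (μ := μ) (hkm 0) hC0
  have hsa := isSelfAdjoint_kernelOp (hkm 0) hC0 (hks 0) hA
  have hcpt := isCompactOperator_kernelOp hC0 hC00 hA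
  have himp := isPositivityImproving_kernelOp (hkm 0) hC0 hk0 hA
  have hA0 := kernelOp_ne_zero (hkm 0) hC0 hk0 hμ0 hA
  obtain ⟨s, b, ν, hbs, hb0⟩ := exists_hilbertBasis_eigenvectors_of_isSelfAdjoint hcpt hsa
  have hb : ∀ i, A (b i) = ν i • b i := fun i => by simpa using hb0 i
  haveI : Fact ((2 : ℝ≥0∞) ≠ ⊤) := ⟨ENNReal.ofNat_ne_top⟩
  have hon : Orthonormal ℝ ((↑) : s → Lp ℝ 2 μ) := hbs ▸ b.orthonormal
  haveI : Countable s := (hon.countable_of_separableSpace (𝕜 := ℝ)).to_subtype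
  -- non-negative eigenvalues, the top eigenvalue `ν_{i₀} = ‖A‖ > 0`, square summability
  have hν0 : ∀ i, 0 ≤ ν i := fun i => by
    rw [lam_eq_inner hb i]; exact inner_kernelOp_self_nonneg hA hpt _
  obtain ⟨ψ, hψ0, hψ⟩ := himp.exists_top_eigenvector_of_isCompactOperator hsa hcpt hA0
  obtain ⟨i₀, hi₀⟩ := exists_index_eq_norm b hsa hb hψ0 hψ
  have hL0 : 0 < ν i₀ := by rw [hi₀]; exact norm_pos_iff.2 hA0
  have hS := hasSum_lam_sq (hkm 0) hC0 hA hb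
  -- Jentzsch's gap: the other eigenvectors are orthogonal to the simple top eigenvector
  obtain ⟨φ, hφ1, -, hAφ, hsimple, θ, hθ0, hθ, hgap⟩ := himp.exists_spectralGap hsa hcpt hA0
  have hbi₀ : b i₀ = ⟪φ, b i₀⟫ • φ := hsimple (b i₀) (by rw [hb, hi₀])
  have hc : ⟪φ, b i₀⟫ ≠ 0 := by
    intro h
    have h1 : b i₀ = 0 := by rw [hbi₀, h, zero_smul]
    have hn := b.orthonormal.norm_eq_one i₀
    rw [h1, norm_zero] at hn
    exact zero_ne_one hn
  have horth : ∀ i, i ≠ i₀ → ⟪φ, b i⟫ = 0 := fun i hi => by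
    have h1 : ⟪b i₀, b i⟫ = 0 := by
      rw [orthonormal_iff_ite.1 b.orthonormal i₀ i, if_neg (Ne.symm hi)]
    rw [hbi₀, real_inner_smul_left] at h1
    exact (mul_eq_zero.1 h1).resolve_left hc
  have hνθ : ∀ i, i ≠ i₀ → ν i ≤ θ := fun i hi => by
    have h := hgap (b i) (horth i hi)
    rwa [hb, norm_smul, Real.norm_eq_abs, b.orthonormal.norm_eq_one i, mul_one, mul_one,
      abs_of_nonneg (hν0 i)] at h
  -- the kernel formula for the powers `A^{m+1} φ = ∫ k_m(·, y) φ(y)`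
  have hApow : ∀ (m : ℕ) (η : Lp ℝ 2 μ), (((A ^ (m + 1)) η : Lp ℝ 2 μ) : X → ℝ) =ᵐ[μ]
      fun x => ∫ y, k m x y * η y ∂μ := by
    intro m
    induction m with
    | zero => intro η; rw [zero_add, pow_one]; exact hA η
    | succ m ih =>
      intro η
      obtain ⟨Cm, hCm⟩ := hkb m
      rw [pow_succ', mul_apply_eq_comp]
      filter_upwards [hA ((A ^ (m + 1)) η)] with x hx
      rw [hx]
      calc ∫ y, k 0 x y * ((A ^ (m + 1)) η : Lp ℝ 2 μ) y ∂μ = ∫ y, k 0 x y * ∫ z, k m y z * η z ∂μ ∂μ :=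
            integral_congr_ae (by filter_upwards [ih η] with y hy; rw [hy])
        _ = ∫ z, (∫ y, k 0 x y * k m y z ∂μ) * η z ∂μ :=
            integral_kernel_mul_integral_kernel_mul_Lp (hkm 0) (hkm m) hC0 hCm η x
        _ = ∫ z, k (m + 1) x z * η z ∂μ := by simp_rw [hcomp]
  -- the trace formulas
  have hZ : ∀ m M : ℕ, HasSum (fun i => (ν i ^ (m + 1)) ^ (M + 2))
      (∫ V : Fin (M + 2) → X, ∏ t, k m (V t) (V (t + 1)) ∂(Measure.pi fun _ => μ)) := fun m M => by
    obtain ⟨Cm, hCm⟩ := hkb m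
    exact hasSum_pow_integral_cyclic (hkm m) hCm (hks m) (hApow m) (fun i => pow_apply_basis hb (m + 1) i)
      (fun i => pow_nonneg (hν0 i) _) M
  refine ⟨s, ν, i₀, θ, hν0, hL0, hθ0, ?_, hνθ, hS.summable, hZ⟩
  rw [hi₀]
  exact hθ

/-! ### Vacuum dominance with a rate from the gap -/

/-- **Two-sided trace domination from a spectral gap.**  If `0 ≤ νᵢ`, `0 < ν_{i₀}`, `θ < ν_{i₀}`, `νᵢ ≤ θ` for
`i ≠ i₀` and `Σ νᵢ² < ∞`, then for every rate `m₀` there are `C ≥ 0` and `L_min ≥ 1` such that for `L ≥ L_min`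
and every `M`, `(ν_{i₀}^L)^{M+2} ≤ Σᵢ (νᵢ^L)^{M+2} ≤ (ν_{i₀}^L)^{M+2} exp(C L e^{−m₀ (M+2)})`: with
`θ' = max θ (ν_{i₀}/2)` and `(θ'/ν_{i₀})^{L_min} ≤ e^{−m₀}`, `Σ_{i ≠ i₀} νᵢ^{L(M+2)} ≤ θ'^{L(M+2)−2} Σ νᵢ²` and
`1 + x ≤ eˣ`. [folklore] -/
theorem vdr_of_spectralGap {ι : Type*} {ν : ι → ℝ} {i₀ : ι} {θ : ℝ} (h0 : ∀ i, 0 ≤ ν i) (hi₀ : 0 < ν i₀)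
    (hθ : θ < ν i₀) (hgap : ∀ i, i ≠ i₀ → ν i ≤ θ) (hS : Summable fun i => ν i ^ 2) (m₀ : ℝ) :
    ∃ C : ℝ, 0 ≤ C ∧ ∃ Lmin : ℕ, 1 ≤ Lmin ∧ ∀ L : ℕ, Lmin ≤ L → ∀ (M : ℕ) (Z : ℝ),
      HasSum (fun i => (ν i ^ L) ^ (M + 2)) Z →
        (ν i₀ ^ L) ^ (M + 2) ≤ Z ∧
          Z ≤ (ν i₀ ^ L) ^ (M + 2) * Real.exp (C * L * Real.exp (-(m₀ * (M + 2)))) := by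
  classical
  -- the effective gap `θ' ∈ [ν₀/2, ν₀)` and its ratio `r ∈ [1/2, 1)`
  set θ' : ℝ := max θ (ν i₀ / 2) with hθ'
  have hθ'0 : 0 < θ' := lt_of_lt_of_le (half_pos hi₀) (le_max_right _ _)
  have hθ'lt : θ' < ν i₀ := max_lt hθ (half_lt_self hi₀)
  have hgap' : ∀ i, i ≠ i₀ → ν i ≤ θ' := fun i hi => (hgap i hi).trans (le_max_left _ _)
  set r : ℝ := θ' / ν i₀ with hr
  have hr0 : 0 < r := div_pos hθ'0 hi₀
  have hr1 : r < 1 := (div_lt_one hi₀).2 hθ'lt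
  have hlogr : 0 < -Real.log r := neg_pos.2 (Real.log_neg hr0 hr1)
  set S₂ : ℝ := ∑' i, ν i ^ 2 with hS₂
  have hS₂0 : 0 ≤ S₂ := tsum_nonneg fun i => sq_nonneg _
  refine ⟨S₂ / θ' ^ 2, div_nonneg hS₂0 (sq_nonneg _), max 1 ⌈m₀ / (-Real.log r)⌉₊, le_max_left _ _,
    fun L hL M Z hZ => ?_⟩
  have hL1 : 1 ≤ L := (le_max_left _ _).trans hL
  have hLceil : m₀ / (-Real.log r) ≤ L := (Nat.le_ceil _).trans (by exact_mod_cast (le_max_right _ _).trans hL)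
  -- `r^L ≤ e^{−m₀}`
  have hrL : r ^ L ≤ Real.exp (-m₀) := by
    rw [← Real.exp_log (pow_pos hr0 L), Real.exp_le_exp, Real.log_pow]
    have h1 : m₀ ≤ L * (-Real.log r) := by rwa [div_le_iff₀ hlogr] at hLceil
    linarith
  set N : ℕ := M + 2 with hN
  have hterm : ∀ i, (ν i ^ L) ^ N = ν i ^ (L * N) := fun i => (pow_mul _ _ _).symm
  refine ⟨?_, ?_⟩
  · -- lower bound: all terms are non-negative
    exact le_hasSum hZ i₀ fun j _ => pow_nonneg (pow_nonneg (h0 j) _) _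
  · -- upper bound: `Z ≤ ν₀^{LN} + θ'^{LN-2} S₂`
    have hLN : 2 ≤ L * N := by nlinarith
    obtain ⟨p, hp⟩ : ∃ p, L * N = p + 2 := ⟨L * N - 2, by omega⟩
    have hbound : ∀ i, (ν i ^ L) ^ N ≤ θ' ^ p * ν i ^ 2 + if i = i₀ then (ν i₀ ^ L) ^ N else 0 := by
      intro i
      by_cases hi : i = i₀
      · subst hi
        rw [if_pos rfl]
        exact le_add_of_nonneg_left (mul_nonneg (pow_nonneg hθ'0.le _) (sq_nonneg _))
      · rw [if_neg hi, add_zero, hterm, hp, pow_add]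
        exact mul_le_mul_of_nonneg_right (pow_le_pow_left₀ (h0 i) (hgap' i hi) p) (sq_nonneg _)
    have hsum : HasSum (fun i => θ' ^ p * ν i ^ 2 + if i = i₀ then (ν i₀ ^ L) ^ N else 0)
        (θ' ^ p * S₂ + (ν i₀ ^ L) ^ N) := (hS.hasSum.mul_left _).add (hasSum_ite_eq i₀ _)
    have hZle : Z ≤ θ' ^ p * S₂ + (ν i₀ ^ L) ^ N := hasSum_le hbound hZ hsum
    -- `θ'^p S₂ = (ν₀^L)^N (S₂/θ'²) r^{LN}` and `r^{LN} ≤ e^{-m₀ N}`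
    have hrLN : r ^ (L * N) ≤ Real.exp (-(m₀ * (M + 2))) := by
      rw [pow_mul, show -(m₀ * (M + 2)) = (N : ℝ) * (-m₀) by rw [hN]; push_cast; ring, Real.exp_nat_mul]
      exact pow_le_pow_left₀ (pow_nonneg hr0.le _) hrL N
    have hkey : θ' ^ p * S₂ = (ν i₀ ^ L) ^ N * (S₂ / θ' ^ 2 * r ^ (L * N)) := by
      rw [← pow_mul, hp, hr, div_pow, pow_add, pow_add]
      field_simp
    have hx : S₂ / θ' ^ 2 * r ^ (L * N) ≤ S₂ / θ' ^ 2 * L * Real.exp (-(m₀ * (M + 2))) := by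
      calc S₂ / θ' ^ 2 * r ^ (L * N) ≤ S₂ / θ' ^ 2 * Real.exp (-(m₀ * (M + 2))) :=
            mul_le_mul_of_nonneg_left hrLN (div_nonneg hS₂0 (sq_nonneg _))
        _ = S₂ / θ' ^ 2 * 1 * Real.exp (-(m₀ * (M + 2))) := by rw [mul_one]
        _ ≤ S₂ / θ' ^ 2 * L * Real.exp (-(m₀ * (M + 2))) := by
            gcongr
            exact_mod_cast hL1
    calc Z ≤ θ' ^ p * S₂ + (ν i₀ ^ L) ^ N := hZle
      _ = (ν i₀ ^ L) ^ N * (1 + S₂ / θ' ^ 2 * r ^ (L * N)) := by rw [hkey]; ring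
      _ ≤ (ν i₀ ^ L) ^ N * Real.exp (S₂ / θ' ^ 2 * r ^ (L * N)) := by
          refine mul_le_mul_of_nonneg_left ?_ (pow_nonneg (pow_nonneg (h0 i₀) _) _)
          linarith [Real.add_one_le_exp (S₂ / θ' ^ 2 * r ^ (L * N))]
      _ ≤ (ν i₀ ^ L) ^ N * Real.exp (S₂ / θ' ^ 2 * L * Real.exp (-(m₀ * (M + 2)))) :=
          mul_le_mul_of_nonneg_left (Real.exp_le_exp.2 hx) (pow_nonneg (pow_nonneg (h0 i₀) _) _)

end Literature.Analysis.OperatorTheory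

end
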